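import Literature.Barriers.CriticalPhenomena.SRWGreenSymbolCalculus
import Mathlib.Analysis.Calculus.IteratedDeriv.Lemmas
import Mathlib.RingTheory.Polynomial.Hermite.Gaussian
import Mathlib.Analysis.SpecialFunctions.Exponential
import HarnessLib

/-!
# The one-dimensional heat kernel symbol `e^{-s(1 - cos k)}` versus the Gaussian `e^{-sk²/2}`:
# structure and bounds of the `k`-derivatives

Second infrastructure file for the proof of `SpreadOutIsing.srwGreen_asymp` (the `O(⟦x⟧^{-d})`
asymptotics of the simple-random-walk Green function; see `SRWGreenSymbolCalculus.lean` for the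
overview). The continuous-time simple random walk on `ℤ^d` with jump rate `1` has the product
heat kernel `p_t(x) = Π_j q_{t/d}(x_j)`, `q_s(m) = (2π)^{-1} ∫_{-π}^{π} e^{ikm} e^{-s(1 - cos k)} dk`,
and the weighted local limit theorem `|m|^N |q_s(m) - (2πs)^{-1/2}e^{-m²/2s}| ≤ C_N s^{(N-3)/2}`
(`SRWGreenLCLT1D.lean`) is, after `N` integrations by parts, an estimate of
`∂_k^N e^{-s(1 - cos k)} - ∂_k^N e^{-sk²/2}`. This file proves the pointwise estimates:

* objects: `heat s k = e^{-s(1 - cos k)}`, `gauss s k = e^{-sk²/2}`, `corr s k = e^{s r(k)}` with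
  `r(k) = cos k - 1 + k²/2`, so that `heat = gauss · corr`;
* structure: `∂^{j+1} corr = corr · F` with `F ∈ GoodSym (j+1) (j-1)`
  (`exists_goodSym_iteratedDeriv_corr`), `∂^N heat = heat · P` with `P ∈ GoodSym N N`
  (`exists_goodSym_iteratedDeriv_heat`), and `∂^n gauss` through Mathlib's Hermite polynomials
  (`iteratedDeriv_gauss`, from `Polynomial.deriv_gaussian_eq_hermite_mul_gaussian`), with
  `|He_n(u)| ≤ A_n (1 + |u|)^n`;
* Leibniz: `∂^N heat = Σ_i (N choose i) ∂^i gauss · ∂^{N-i} corr`;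
* bounds, uniformly in `s ≥ 1`: NEAR (`|k| ≤ 1`):
  `|∂^N heat - ∂^N gauss| ≤ C √s^{N-2} e^{-sk²/8}` (`exists_near_bound`) — the extra `√s^{-2} = s^{-1}`
  relative to `|∂^N gauss| ≲ √s^N` is the first Edgeworth correction; FAR on the torus
  (`1 ≤ |k| ≤ π`): `|∂^N heat| ≤ C s^N e^{-(2/π²)s}` (`exists_far_bound_heat`); Gaussian tails:
  `|∂^N gauss| ≤ C √s^N e^{-sk²/4}` everywhere and `≤ C √s^N e^{-s/4} e^{-sk²/8}` for `|k| ≥ 1`.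

## References

* G. F. Lawler, V. Limic, *Random Walk: A Modern Introduction*, CUP 2010, §2.3 (LCLT via the
  characteristic function; the role of the fourth cumulant) and Thm. 4.3.1.
* K. Uchiyama, Proc. LMS 77 (1998) 215–240, Thm. 2.
-/

noncomputable section

namespace Literature.Barriers.CriticalPhenomena

namespace SRWGreen

open Real Polynomial Finset

/-! ### The three symbols -/

/-- `r(k) = cos k - 1 + k²/2 ∈ [0, (5/96) k⁴]` (`|k| ≤ 1`), the quartic defect of `1 - cos k`.
[folklore] -/
def rr (k : ℝ) : ℝ := Real.cos k - 1 + k ^ 2 / 2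

/-- The heat symbol `e^{-s(1 - cos k)}` of the rate-one continuous-time simple random walk on `ℤ`
(characteristic function of its time-`s` law). [folklore] -/
def heat (s k : ℝ) : ℝ := Real.exp (-(s * (1 - Real.cos k)))

/-- The Gaussian symbol `e^{-sk²/2}`. [folklore] -/
def gauss (s k : ℝ) : ℝ := Real.exp (-(s * k ^ 2 / 2))

/-- The correction factor `e^{s r(k)}`, `heat = gauss · corr`. [folklore] -/
def corr (s k : ℝ) : ℝ := Real.exp (s * rr k)

/-- Mathlib's standard Gaussian `G(u) = e^{-u²/2}` (the function of
`Polynomial.deriv_gaussian_eq_hermite_mul_gaussian`). [folklore] -/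
def stdGauss (u : ℝ) : ℝ := Real.exp (-(u ^ 2 / 2))

/-- `heat = gauss · corr`. [folklore] -/
theorem heat_eq_gauss_mul_corr (s : ℝ) : heat s = fun k => gauss s k * corr s k := by
  funext k
  unfold heat gauss corr rr
  rw [← Real.exp_add]
  congr 1; ring

/-- `heat s = gauss s * corr s` as a product of functions. [folklore] -/
theorem heat_eq_mul (s : ℝ) : heat s = gauss s * corr s := by
  rw [heat_eq_gauss_mul_corr]; rfl

/-- `gauss s k = G(√s k)` for `s ≥ 0`. [folklore] -/
theorem gauss_eq_stdGauss {s : ℝ} (hs : 0 ≤ s) : gauss s = fun k => stdGauss (Real.sqrt s * k) := by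
  funext k
  unfold gauss stdGauss
  congr 1
  rw [mul_pow, Real.sq_sqrt hs]

/-- `0 < heat`. [folklore] -/
theorem heat_pos (s k : ℝ) : 0 < heat s k := Real.exp_pos _

/-- `0 < corr`. [folklore] -/
theorem corr_pos (s k : ℝ) : 0 < corr s k := Real.exp_pos _

/-- `0 < gauss`. [folklore] -/
theorem gauss_pos (s k : ℝ) : 0 < gauss s k := Real.exp_pos _

/-- `heat ≤ 1` for `s ≥ 0`. [folklore] -/
theorem heat_le_one {s : ℝ} (hs : 0 ≤ s) (k : ℝ) : heat s k ≤ 1 := by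
  unfold heat
  rw [Real.exp_le_one_iff, neg_nonpos]
  exact mul_nonneg hs (by linarith [Real.cos_le_one k])

/-- `0 ≤ r(k)` (`1 - k²/2 ≤ cos k`). [folklore] -/
theorem rr_nonneg (k : ℝ) : 0 ≤ rr k := by
  unfold rr; linarith [Real.one_sub_sq_div_two_le_cos (x := k)]

/-- `r(k) ≤ (5/96) k⁴ ≤ (5/96) k²` for `|k| ≤ 1` (Mathlib's `Real.cos_bound`). [folklore] -/
theorem rr_le {k : ℝ} (hk : |k| ≤ 1) : rr k ≤ 5 / 96 * k ^ 2 := by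
  have h := Real.cos_bound hk
  have h1 : rr k ≤ |k| ^ 4 * (5 / 96) := by
    have : rr k = Real.cos k - (1 - k ^ 2 / 2) := by unfold rr; ring
    rw [this]; exact (le_abs_self _).trans h
  have h2 : |k| ^ 4 ≤ |k| ^ 2 := by
    calc |k| ^ 4 = |k| ^ 2 * |k| ^ 2 := by ring
      _ ≤ |k| ^ 2 * 1 := by
          refine mul_le_mul_of_nonneg_left ?_ (sq_nonneg _)
          calc |k| ^ 2 ≤ 1 ^ 2 := pow_le_pow_left₀ (abs_nonneg k) hk 2
            _ = 1 := one_pow 2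
      _ = |k| ^ 2 := mul_one _
  rw [sq_abs] at h2
  nlinarith

/-- `r(k) ≤ (5/96) k⁴` for `|k| ≤ 1` (Mathlib's `Real.cos_bound`). [folklore] -/
theorem rr_le_pow_four {k : ℝ} (hk : |k| ≤ 1) : rr k ≤ 5 / 96 * k ^ 4 := by
  have h := Real.cos_bound hk
  have : rr k = Real.cos k - (1 - k ^ 2 / 2) := by unfold rr; ring
  rw [this]
  have h4 : |k| ^ 4 = k ^ 4 := by
    rw [show (4 : ℕ) = 2 * 2 from rfl, pow_mul, pow_mul, sq_abs]
  calc Real.cos k - (1 - k ^ 2 / 2) ≤ |Real.cos k - (1 - k ^ 2 / 2)| := le_abs_self _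
    _ ≤ |k| ^ 4 * (5 / 96) := h
    _ = 5 / 96 * k ^ 4 := by rw [h4]; ring

/-- The heat symbol is `2π`-periodic in `k`. [folklore] -/
theorem heat_periodic (s : ℝ) : Function.Periodic (heat s) (2 * Real.pi) := fun k => by
  unfold heat; rw [Real.cos_add_two_pi]

/-! ### Smoothness -/

/-- `k ↦ e^{-s(1 - cos k)}` is smooth. [folklore] -/
theorem contDiff_heat (n : ℕ) (s : ℝ) : ContDiff ℝ n (heat s) := by
  unfold heat; fun_prop

/-- `k ↦ e^{-sk²/2}` is smooth. [folklore] -/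
theorem contDiff_gauss (n : ℕ) (s : ℝ) : ContDiff ℝ n (gauss s) := by
  unfold gauss; fun_prop

/-- `k ↦ e^{s r(k)}` is smooth. [folklore] -/
theorem contDiff_corr (n : ℕ) (s : ℝ) : ContDiff ℝ n (corr s) := by
  unfold corr rr; fun_prop

/-- `G` is smooth. [folklore] -/
theorem contDiff_stdGauss (n : ℕ) : ContDiff ℝ n stdGauss := by
  unfold stdGauss; fun_prop

/-- `corr' = corr · (s u₁)` (`r' = k - sin k = u₁`). [folklore] -/
theorem hasDerivAt_corr (s k : ℝ) : HasDerivAt (corr s) (corr s k * (s * u₁ k)) k := by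
  have hr : HasDerivAt rr (u₁ k) k := by
    have h := ((Real.hasDerivAt_cos k).sub (hasDerivAt_const k (1 : ℝ))).add
      ((hasDerivAt_pow 2 k).div_const 2)
    refine h.congr_deriv ?_
    unfold u₁; push_cast; ring
  exact (hr.const_mul s).exp

/-- `heat' = heat · (-(s u₃))` (`(1 - cos k)' = sin k = u₃`). [folklore] -/
theorem hasDerivAt_heat (s k : ℝ) : HasDerivAt (heat s) (heat s k * (-(s * u₃ k))) k := by
  have h1 : HasDerivAt (fun k => -(s * (1 - Real.cos k))) (-(s * u₃ k)) k := by
    have h := ((hasDerivAt_const k (1 : ℝ)).sub (Real.hasDerivAt_cos k)).const_mul s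
    have e : s * (0 - -Real.sin k) = s * u₃ k := by unfold u₃; ring
    rw [e] at h
    exact h.neg
  exact h1.exp

/-! ### Structure of the derivatives: `∂^{j+1} corr = corr · F_j`, `∂^N heat = heat · P_N` -/

/-- **The symbols of `∂^{j+1} e^{s r}`**: for every `j` there is `F ∈ GoodSym (j+1) (j-1)` with
`∂_k^{j+1} e^{s r(k)} = e^{s r(k)} F(s,k)` for all `s, k`. (Induction: `∂(e^{sr}F) = e^{sr}(s u₁ F + F')`,
and `s u₁ ·` lowers the weight by one while `∂_k` raises it by one.) [folklore] -/
theorem exists_goodSym_iteratedDeriv_corr (j : ℕ) :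
    ∃ F : ℝ → ℝ → ℝ, GoodSym (j + 1) ((j : ℤ) - 1) F ∧
      ∀ s k, iteratedDeriv (j + 1) (corr s) k = corr s k * F s k := by
  induction j with
  | zero =>
    refine ⟨fun s k => s * u₁ k, by simpa using goodSym_s_u₁, fun s k => ?_⟩
    rw [zero_add, iteratedDeriv_one]
    exact (hasDerivAt_corr s k).deriv
  | succ j ih =>
    obtain ⟨F, hF, hFd⟩ := ih
    obtain ⟨F', hF', hF'd⟩ := hF.exists_hasDerivAt
    refine ⟨fun s k => s * u₁ k * F s k + F' s k, ?_, fun s k => ?_⟩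
    · have h1 : GoodSym (j + 1 + 1) (((j + 1 : ℕ) : ℤ) - 1) (fun s k => s * u₁ k * F s k) :=
        hF.mul_s_u₁.weaken le_rfl (by push_cast; omega)
      have h2 : GoodSym (j + 1 + 1) (((j + 1 : ℕ) : ℤ) - 1) F' :=
        hF'.weaken (by omega) (by push_cast; omega)
      exact GoodSym.add _ _ h1 h2
    · rw [iteratedDeriv_succ]
      have hfun : iteratedDeriv (j + 1) (corr s) = fun k => corr s k * F s k := funext (hFd s)
      rw [hfun]
      have hd : HasDerivAt (fun k => corr s k * F s k)
          (corr s k * (s * u₁ k) * F s k + corr s k * F' s k) k :=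
        (hasDerivAt_corr s k).mul (hF'd s k)
      rw [hd.deriv]
      ring

/-- **The symbols of `∂^N e^{-s(1 - cos k)}`**: for every `N` there is `P ∈ GoodSym N N` with
`∂_k^N e^{-s(1 - cos k)} = e^{-s(1 - cos k)} P(s,k)` for all `s, k`. [folklore] -/
theorem exists_goodSym_iteratedDeriv_heat (N : ℕ) :
    ∃ P : ℝ → ℝ → ℝ, GoodSym N (N : ℤ) P ∧ ∀ s k, iteratedDeriv N (heat s) k = heat s k * P s k := by
  induction N with
  | zero =>
    refine ⟨fun _ _ => 1, by simpa using goodSym_one, fun s k => ?_⟩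
    rw [iteratedDeriv_zero, mul_one]
  | succ N ih =>
    obtain ⟨P, hP, hPd⟩ := ih
    obtain ⟨P', hP', hP'd⟩ := hP.exists_hasDerivAt
    refine ⟨fun s k => -(s * u₃ k * P s k) + P' s k, ?_, fun s k => ?_⟩
    · have h1 : GoodSym (N + 1) ((N + 1 : ℕ) : ℤ) (fun s k => -(s * u₃ k * P s k)) := by
        have := hP.mul_s_u₃.neg
        exact this.weaken le_rfl (by push_cast; omega)
      have h2 : GoodSym (N + 1) ((N + 1 : ℕ) : ℤ) P' := hP'.weaken (by omega) (by push_cast; omega)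
      exact GoodSym.add _ _ h1 h2
    · rw [iteratedDeriv_succ]
      have hfun : iteratedDeriv N (heat s) = fun k => heat s k * P s k := funext (hPd s)
      rw [hfun]
      have hd : HasDerivAt (fun k => heat s k * P s k)
          (heat s k * (-(s * u₃ k)) * P s k + heat s k * P' s k) k :=
        (hasDerivAt_heat s k).mul (hP'd s k)
      rw [hd.deriv]
      ring

/-- The iterated derivatives of the heat symbol are `2π`-periodic. [folklore] -/
theorem iteratedDeriv_heat_periodic (N : ℕ) (s : ℝ) :
    Function.Periodic (iteratedDeriv N (heat s)) (2 * Real.pi) := fun k => by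
  have h := iteratedDeriv_comp_add_const N (heat s) (2 * Real.pi)
  have hfun : (fun z => heat s (z + 2 * Real.pi)) = heat s := funext (heat_periodic s)
  rw [hfun] at h
  exact (congrFun h k).symm

/-- `∂^N heat` has derivative `∂^{N+1} heat`. [folklore] -/
theorem hasDerivAt_iteratedDeriv_heat (N : ℕ) (s k : ℝ) :
    HasDerivAt (iteratedDeriv N (heat s)) (iteratedDeriv (N + 1) (heat s) k) k := by
  rw [iteratedDeriv_succ]
  exact (((contDiff_heat (N + 1) s).differentiable_iteratedDeriv' N) k).hasDerivAt

/-- `∂^N gauss` has derivative `∂^{N+1} gauss`. [folklore] -/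
theorem hasDerivAt_iteratedDeriv_gauss (N : ℕ) (s k : ℝ) :
    HasDerivAt (iteratedDeriv N (gauss s)) (iteratedDeriv (N + 1) (gauss s) k) k := by
  rw [iteratedDeriv_succ]
  exact (((contDiff_gauss (N + 1) s).differentiable_iteratedDeriv' N) k).hasDerivAt

/-- `∂^N heat` is continuous. [folklore] -/
theorem continuous_iteratedDeriv_heat (N : ℕ) (s : ℝ) : Continuous (iteratedDeriv N (heat s)) :=
  (contDiff_heat N s).continuous_iteratedDeriv' N

/-- `∂^N gauss` is continuous. [folklore] -/
theorem continuous_iteratedDeriv_gauss (N : ℕ) (s : ℝ) : Continuous (iteratedDeriv N (gauss s)) :=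
  (contDiff_gauss N s).continuous_iteratedDeriv' N

/-! ### The Gaussian derivatives through Hermite polynomials -/

/-- `∂^n G(u) = (-1)^n He_n(u) G(u)` (Mathlib). [folklore] -/
theorem iteratedDeriv_stdGauss (n : ℕ) (u : ℝ) :
    iteratedDeriv n stdGauss u = (-1 : ℝ) ^ n * aeval u (hermite n) * stdGauss u := by
  rw [iteratedDeriv_eq_iterate]
  exact Polynomial.deriv_gaussian_eq_hermite_mul_gaussian n u

/-- **`∂_k^n e^{-sk²/2} = √s^n (-1)^n He_n(√s k) e^{-sk²/2}`** (`s ≥ 0`). [folklore] -/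
theorem iteratedDeriv_gauss (n : ℕ) {s : ℝ} (hs : 0 ≤ s) (k : ℝ) :
    iteratedDeriv n (gauss s) k =
      Real.sqrt s ^ n * ((-1 : ℝ) ^ n * aeval (Real.sqrt s * k) (hermite n) * stdGauss (Real.sqrt s * k)) := by
  rw [gauss_eq_stdGauss hs, iteratedDeriv_comp_const_mul (contDiff_stdGauss n) (Real.sqrt s)]
  simp only [iteratedDeriv_stdGauss]

/-- `A_n := Σ_{i ≤ n} |coeff_i(He_n)|`. [folklore] -/
def hermBound (n : ℕ) : ℝ := ∑ i ∈ Finset.range (n + 1), |(((hermite n).coeff i : ℤ) : ℝ)|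

/-- `0 ≤ A_n`. [folklore] -/
theorem hermBound_nonneg (n : ℕ) : 0 ≤ hermBound n :=
  Finset.sum_nonneg fun _ _ => abs_nonneg _

/-- `|He_n(u)| ≤ A_n (1 + |u|)^n`. [folklore] -/
theorem abs_aeval_hermite_le (n : ℕ) (u : ℝ) :
    |aeval u (hermite n)| ≤ hermBound n * (1 + |u|) ^ n := by
  rw [Polynomial.aeval_eq_sum_range, Polynomial.natDegree_hermite, hermBound, Finset.sum_mul]
  refine (Finset.abs_sum_le_sum_abs _ _).trans (Finset.sum_le_sum fun i hi => ?_)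
  rw [Finset.mem_range] at hi
  rw [zsmul_eq_mul, abs_mul, abs_pow]
  refine mul_le_mul_of_nonneg_left ?_ (abs_nonneg _)
  calc |u| ^ i ≤ (1 + |u|) ^ i := pow_le_pow_left₀ (abs_nonneg u) (by linarith [abs_nonneg u]) i
    _ ≤ (1 + |u|) ^ n := pow_le_pow_right₀ (by linarith [abs_nonneg u]) (by omega)

/-- **The Gaussian derivative bound** `|∂_k^n e^{-sk²/2}| ≤ A_n √s^n (1 + √s|k|)^n e^{-sk²/2}`
(`s ≥ 0`). [folklore] -/
theorem abs_iteratedDeriv_gauss_le (n : ℕ) {s : ℝ} (hs : 0 ≤ s) (k : ℝ) :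
    |iteratedDeriv n (gauss s) k| ≤
      hermBound n * Real.sqrt s ^ n * (1 + Real.sqrt s * |k|) ^ n * gauss s k := by
  rw [iteratedDeriv_gauss n hs k]
  have hG : stdGauss (Real.sqrt s * k) = gauss s k := by rw [gauss_eq_stdGauss hs]
  rw [hG, abs_mul, abs_mul, abs_mul, abs_pow, abs_pow, abs_neg, abs_one, one_pow, one_mul,
    abs_of_nonneg (Real.sqrt_nonneg s), abs_of_pos (gauss_pos s k)]
  have h := abs_aeval_hermite_le n (Real.sqrt s * k)
  rw [abs_mul, abs_of_nonneg (Real.sqrt_nonneg s)] at h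
  have h0 : 0 ≤ Real.sqrt s ^ n := pow_nonneg (Real.sqrt_nonneg s) n
  calc Real.sqrt s ^ n * (|aeval (Real.sqrt s * k) (hermite n)| * gauss s k)
      ≤ Real.sqrt s ^ n * (hermBound n * (1 + Real.sqrt s * |k|) ^ n * gauss s k) :=
        mul_le_mul_of_nonneg_left (mul_le_mul_of_nonneg_right h (gauss_pos s k).le) h0
    _ = _ := by ring

/-! ### Leibniz -/

/-- **Leibniz**: `∂^N heat = Σ_{i ≤ N} (N choose i) ∂^i gauss · ∂^{N-i} corr`. [folklore] -/
theorem iteratedDeriv_heat_eq_sum (N : ℕ) (s k : ℝ) :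
    iteratedDeriv N (heat s) k = ∑ i ∈ Finset.range (N + 1),
      (N.choose i : ℝ) * iteratedDeriv i (gauss s) k * iteratedDeriv (N - i) (corr s) k := by
  rw [heat_eq_mul]
  exact iteratedDeriv_mul (contDiff_gauss N s).contDiffAt (contDiff_corr N s).contDiffAt

/-! ### Elementary exponential inequalities -/

/-- `e^x - 1 ≤ x e^x` (from `1 - x ≤ e^{-x}`). [folklore] -/
theorem exp_sub_one_le_mul_exp (x : ℝ) : Real.exp x - 1 ≤ x * Real.exp x := by
  have h := Real.add_one_le_exp (-x)
  have hpos := Real.exp_pos x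
  have h2 : Real.exp x * (-x + 1) ≤ Real.exp x * Real.exp (-x) := mul_le_mul_of_nonneg_left h hpos.le
  rw [← Real.exp_add, add_neg_cancel, Real.exp_zero] at h2
  nlinarith

/-- `0 ≤ e^x - 1` for `x ≥ 0`. [folklore] -/
theorem exp_sub_one_nonneg {x : ℝ} (hx : 0 ≤ x) : 0 ≤ Real.exp x - 1 := by
  have := Real.one_le_exp hx
  linarith

/-- **Polynomial times Gaussian is bounded**: for `M ∈ ℕ`, `b > 0` there is `B ≥ 0` with
`(1 + x)^M e^{-bx²} ≤ B` for all `x ≥ 0` (via `yⁿ/n! ≤ e^y`). [folklore] -/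
theorem exists_pow_mul_exp_neg_sq_le (M : ℕ) {b : ℝ} (hb : 0 < b) :
    ∃ B : ℝ, 0 ≤ B ∧ ∀ x : ℝ, 0 ≤ x → (1 + x) ^ M * Real.exp (-(b * x ^ 2)) ≤ B := by
  refine ⟨2 ^ M * (1 + (M.factorial : ℝ) / b ^ M), by positivity, fun x hx => ?_⟩
  have hexp : Real.exp (-(b * x ^ 2)) ≤ 1 := by
    rw [Real.exp_le_one_iff, neg_nonpos]; positivity
  have hexp0 : 0 < Real.exp (-(b * x ^ 2)) := Real.exp_pos _
  have hfac : (0 : ℝ) < M.factorial := by exact_mod_cast M.factorial_pos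
  -- `x^{2M} e^{-bx²} ≤ M!/b^M`
  have hkey : x ^ (2 * M) * Real.exp (-(b * x ^ 2)) ≤ (M.factorial : ℝ) / b ^ M := by
    have h := Real.pow_div_factorial_le_exp (b * x ^ 2) (by positivity) M
    rw [div_le_iff₀ hfac, mul_pow, ← pow_mul, mul_comm 2 M] at h
    rw [le_div_iff₀ (pow_pos hb M), Real.exp_neg]
    have hbM : 0 < b ^ M := pow_pos hb M
    have hE : 0 < Real.exp (b * x ^ 2) := Real.exp_pos _
    rw [mul_comm 2 M] at *
    calc x ^ (M * 2) * (Real.exp (b * x ^ 2))⁻¹ * b ^ M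
        = (b ^ M * x ^ (M * 2)) / Real.exp (b * x ^ 2) := by field_simp
      _ ≤ (Real.exp (b * x ^ 2) * M.factorial) / Real.exp (b * x ^ 2) :=
          div_le_div_of_nonneg_right h hE.le
      _ = M.factorial := by field_simp
  rcases le_total x 1 with hx1 | hx1
  · -- `x ≤ 1`: `(1+x)^M e^{-bx²} ≤ 2^M`
    calc (1 + x) ^ M * Real.exp (-(b * x ^ 2)) ≤ (2 : ℝ) ^ M * 1 := by
          refine mul_le_mul (pow_le_pow_left₀ (by linarith) (by linarith) M) hexp hexp0.le (by positivity)
      _ ≤ 2 ^ M * (1 + (M.factorial : ℝ) / b ^ M) := by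
          refine mul_le_mul_of_nonneg_left ?_ (by positivity)
          have : 0 ≤ (M.factorial : ℝ) / b ^ M := by positivity
          linarith
  · -- `x ≥ 1`: `(1+x)^M ≤ 2^M x^M ≤ 2^M x^{2M}`
    have h1 : (1 + x) ^ M ≤ (2 : ℝ) ^ M * x ^ (2 * M) := by
      calc (1 + x) ^ M ≤ (2 * x) ^ M := pow_le_pow_left₀ (by linarith) (by linarith) M
        _ = 2 ^ M * x ^ M := mul_pow 2 x M
        _ ≤ 2 ^ M * x ^ (2 * M) := by
            refine mul_le_mul_of_nonneg_left (pow_le_pow_right₀ hx1 (by omega)) (by positivity)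
    calc (1 + x) ^ M * Real.exp (-(b * x ^ 2)) ≤ (2 : ℝ) ^ M * x ^ (2 * M) * Real.exp (-(b * x ^ 2)) :=
          mul_le_mul_of_nonneg_right h1 hexp0.le
      _ = 2 ^ M * (x ^ (2 * M) * Real.exp (-(b * x ^ 2))) := by ring
      _ ≤ 2 ^ M * ((M.factorial : ℝ) / b ^ M) := mul_le_mul_of_nonneg_left hkey (by positivity)
      _ ≤ 2 ^ M * (1 + (M.factorial : ℝ) / b ^ M) := by
          refine mul_le_mul_of_nonneg_left (by linarith) (by positivity)

/-- `(√s |k|)² = s k²` (`s ≥ 0`). [folklore] -/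
theorem sqrt_mul_abs_sq {s : ℝ} (hs : 0 ≤ s) (k : ℝ) : (Real.sqrt s * |k|) ^ 2 = s * k ^ 2 := by
  rw [mul_pow, Real.sq_sqrt hs, sq_abs]

/-- **The absorption step**: for every `M` there is `B ≥ 0` such that for `s ≥ 0` and all `k`,
`(1 + √s|k|)^M e^{-sk²/2} e^{(5/96) s k²} ≤ B e^{-sk²/8}` (the Gaussian `e^{-sk²/2}` beats the
correction `e^{s r(k)} ≤ e^{(5/96)sk²}` and any polynomial weight). [folklore] -/
theorem exists_absorb (M : ℕ) :
    ∃ B : ℝ, 0 ≤ B ∧ ∀ s : ℝ, 0 ≤ s → ∀ k : ℝ,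
      (1 + Real.sqrt s * |k|) ^ M * gauss s k * Real.exp (5 / 96 * (s * k ^ 2)) ≤
        B * Real.exp (-(s * k ^ 2 / 8)) := by
  obtain ⟨B, hB, h⟩ := exists_pow_mul_exp_neg_sq_le M (show (0 : ℝ) < 31 / 96 by norm_num)
  refine ⟨B, hB, fun s hs k => ?_⟩
  have hkey := h _ (mul_nonneg (Real.sqrt_nonneg s) (abs_nonneg k))
  rw [sqrt_mul_abs_sq hs] at hkey
  have hE : gauss s k * Real.exp (5 / 96 * (s * k ^ 2)) =
      Real.exp (-(31 / 96 * (s * k ^ 2))) * Real.exp (-(s * k ^ 2 / 8)) := by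
    unfold gauss
    rw [← Real.exp_add, ← Real.exp_add]
    congr 1; ring
  calc (1 + Real.sqrt s * |k|) ^ M * gauss s k * Real.exp (5 / 96 * (s * k ^ 2))
      = (1 + Real.sqrt s * |k|) ^ M * Real.exp (-(31 / 96 * (s * k ^ 2))) * Real.exp (-(s * k ^ 2 / 8)) := by
        rw [mul_assoc, hE, ← mul_assoc]
    _ ≤ B * Real.exp (-(s * k ^ 2 / 8)) := mul_le_mul_of_nonneg_right hkey (Real.exp_pos _).le

/-- `corr s k ≤ e^{(5/96) s k²}` for `s ≥ 0`, `|k| ≤ 1`. [folklore] -/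
theorem corr_le {s k : ℝ} (hs : 0 ≤ s) (hk : |k| ≤ 1) : corr s k ≤ Real.exp (5 / 96 * (s * k ^ 2)) := by
  unfold corr
  refine Real.exp_le_exp.2 ?_
  have := rr_le hk
  nlinarith

/-- `0 ≤ corr s k - 1 ≤ (5/96) s k⁴ e^{(5/96) s k²}` for `s ≥ 0`, `|k| ≤ 1`. [folklore] -/
theorem abs_corr_sub_one_le {s k : ℝ} (hs : 0 ≤ s) (hk : |k| ≤ 1) :
    |corr s k - 1| ≤ 5 / 96 * (s * k ^ 4) * Real.exp (5 / 96 * (s * k ^ 2)) := by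
  have hx : 0 ≤ s * rr k := mul_nonneg hs (rr_nonneg k)
  unfold corr
  rw [abs_of_nonneg (exp_sub_one_nonneg hx)]
  calc Real.exp (s * rr k) - 1 ≤ s * rr k * Real.exp (s * rr k) := exp_sub_one_le_mul_exp _
    _ ≤ 5 / 96 * (s * k ^ 4) * Real.exp (5 / 96 * (s * k ^ 2)) := by
        refine mul_le_mul ?_ (corr_le hs hk) (Real.exp_pos _).le (by positivity)
        have := rr_le_pow_four hk
        nlinarith

/-- `√s ≠ 0`, `0 < √s`, `1 ≤ √s` for `s ≥ 1`. [folklore] -/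
theorem one_le_sqrt_of_one_le {s : ℝ} (hs : 1 ≤ s) : 1 ≤ Real.sqrt s := Real.one_le_sqrt.2 hs

/-! ### The near bound -/

/-- The `i < N` Leibniz terms: `|∂^i gauss · ∂^j corr| ≤ C √s^{i+j-2} e^{-sk²/8}` for `j ≥ 1`,
`s ≥ 1`, `|k| ≤ 1`. [folklore] -/
theorem exists_cross_term_bound (i m : ℕ) :
    ∃ C : ℝ, 0 ≤ C ∧ ∀ s : ℝ, 1 ≤ s → ∀ k : ℝ, |k| ≤ 1 →
      |iteratedDeriv i (gauss s) k * iteratedDeriv (m + 1) (corr s) k| ≤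
        C * Real.sqrt s ^ ((i : ℤ) + m - 1) * Real.exp (-(s * k ^ 2 / 8)) := by
  obtain ⟨F, hF, hFd⟩ := exists_goodSym_iteratedDeriv_corr m
  obtain ⟨CF, hCF, Q, hFb⟩ := hF.near_bound
  obtain ⟨B, hB, hAbs⟩ := exists_absorb (i + Q)
  refine ⟨hermBound i * CF * B, by positivity [hermBound_nonneg i], fun s hs k hk => ?_⟩
  have hs0 : 0 ≤ s := by linarith
  have hr0 : 0 < Real.sqrt s := by linarith [one_le_sqrt_of_one_le hs]
  set x : ℝ := Real.sqrt s * |k| with hx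
  have hx0 : 0 ≤ x := mul_nonneg hr0.le (abs_nonneg k)
  have hx1 : 1 ≤ 1 + x := by linarith
  rw [hFd s k, abs_mul, abs_mul, abs_of_pos (corr_pos s k)]
  have hg := abs_iteratedDeriv_gauss_le i hs0 k
  have hFk := hFb s hs k hk
  have hcorr := corr_le hs0 hk
  have hA := hAbs s hs0 k
  -- combine
  have h1 : |iteratedDeriv i (gauss s) k| * (corr s k * |F s k|) ≤
      (hermBound i * Real.sqrt s ^ i * (1 + x) ^ i * gauss s k) *
        (Real.exp (5 / 96 * (s * k ^ 2)) * (CF * Real.sqrt s ^ ((m : ℤ) - 1) * (1 + x) ^ Q)) := by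
    refine mul_le_mul hg (mul_le_mul hcorr hFk (abs_nonneg _) (Real.exp_pos _).le)
      (mul_nonneg (corr_pos s k).le (abs_nonneg _)) ?_
    have := hermBound_nonneg i
    have := gauss_pos s k
    positivity
  refine h1.trans ?_
  have hpow : (1 + x) ^ i * (1 + x) ^ Q = (1 + x) ^ (i + Q) := (pow_add _ _ _).symm
  have hz : Real.sqrt s ^ i * Real.sqrt s ^ ((m : ℤ) - 1) = Real.sqrt s ^ ((i : ℤ) + m - 1) := by
    rw [← zpow_natCast, ← zpow_add₀ hr0.ne']
    congr 1; ring
  calc hermBound i * Real.sqrt s ^ i * (1 + x) ^ i * gauss s k *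
        (Real.exp (5 / 96 * (s * k ^ 2)) * (CF * Real.sqrt s ^ ((m : ℤ) - 1) * (1 + x) ^ Q))
      = hermBound i * CF * (Real.sqrt s ^ i * Real.sqrt s ^ ((m : ℤ) - 1)) *
          (((1 + x) ^ i * (1 + x) ^ Q) * gauss s k * Real.exp (5 / 96 * (s * k ^ 2))) := by ring
    _ = hermBound i * CF * Real.sqrt s ^ ((i : ℤ) + m - 1) *
          ((1 + x) ^ (i + Q) * gauss s k * Real.exp (5 / 96 * (s * k ^ 2))) := by rw [hpow, hz]
    _ ≤ hermBound i * CF * Real.sqrt s ^ ((i : ℤ) + m - 1) * (B * Real.exp (-(s * k ^ 2 / 8))) := by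
        refine mul_le_mul_of_nonneg_left hA ?_
        have := hermBound_nonneg i
        have := zpow_nonneg hr0.le ((i : ℤ) + m - 1)
        positivity
    _ = hermBound i * CF * B * Real.sqrt s ^ ((i : ℤ) + m - 1) * Real.exp (-(s * k ^ 2 / 8)) := by ring

/-- The main Leibniz term against the Gaussian: `|∂^N gauss · (corr - 1)| ≤ C √s^{N-2} e^{-sk²/8}`
for `s ≥ 1`, `|k| ≤ 1` — here `corr - 1 = O(s k⁴) = O(s^{-1} (√s k)⁴)` supplies the factor `s^{-1}`.
[folklore] -/
theorem exists_main_term_bound (N : ℕ) :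
    ∃ C : ℝ, 0 ≤ C ∧ ∀ s : ℝ, 1 ≤ s → ∀ k : ℝ, |k| ≤ 1 →
      |iteratedDeriv N (gauss s) k * (corr s k - 1)| ≤
        C * Real.sqrt s ^ ((N : ℤ) - 2) * Real.exp (-(s * k ^ 2 / 8)) := by
  obtain ⟨B, hB, hAbs⟩ := exists_absorb (N + 4)
  refine ⟨hermBound N * (5 / 96) * B, by positivity [hermBound_nonneg N], fun s hs k hk => ?_⟩
  have hs0 : 0 ≤ s := by linarith
  have hr0 : 0 < Real.sqrt s := by linarith [one_le_sqrt_of_one_le hs]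
  set x : ℝ := Real.sqrt s * |k| with hx
  have hx0 : 0 ≤ x := mul_nonneg hr0.le (abs_nonneg k)
  have hx1 : 1 ≤ 1 + x := by linarith
  rw [abs_mul]
  have hg := abs_iteratedDeriv_gauss_le N hs0 k
  have hc := abs_corr_sub_one_le hs0 hk
  have hA := hAbs s hs0 k
  -- `s k⁴ = √s^{-2} x⁴ ≤ √s^{-2} (1+x)^4`
  have hsk4 : s * k ^ 4 = Real.sqrt s ^ (-2 : ℤ) * x ^ 4 := by
    have hx4 : x ^ 4 = s ^ 2 * k ^ 4 := by
      rw [show (4 : ℕ) = 2 * 2 from rfl, pow_mul, hx, sqrt_mul_abs_sq hs0]; ring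
    rw [hx4, show (-2 : ℤ) = -((2 : ℕ) : ℤ) from rfl, zpow_neg, zpow_natCast, Real.sq_sqrt hs0]
    have : s ≠ 0 := by linarith
    field_simp
  have hx4le : x ^ 4 ≤ (1 + x) ^ 4 := pow_le_pow_left₀ hx0 (by linarith) 4
  have h1 : |iteratedDeriv N (gauss s) k| * |corr s k - 1| ≤
      (hermBound N * Real.sqrt s ^ N * (1 + x) ^ N * gauss s k) *
        (5 / 96 * (Real.sqrt s ^ (-2 : ℤ) * (1 + x) ^ 4) * Real.exp (5 / 96 * (s * k ^ 2))) := by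
    refine mul_le_mul hg (hc.trans ?_) (abs_nonneg _) ?_
    · rw [hsk4]
      refine mul_le_mul_of_nonneg_right (mul_le_mul_of_nonneg_left
        (mul_le_mul_of_nonneg_left hx4le (zpow_nonneg hr0.le _)) (by norm_num)) (Real.exp_pos _).le
    · have := hermBound_nonneg N
      have := gauss_pos s k
      positivity
  refine h1.trans ?_
  have hpow : (1 + x) ^ N * (1 + x) ^ 4 = (1 + x) ^ (N + 4) := (pow_add _ _ _).symm
  have hz : Real.sqrt s ^ N * Real.sqrt s ^ (-2 : ℤ) = Real.sqrt s ^ ((N : ℤ) - 2) := by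
    rw [← zpow_natCast, ← zpow_add₀ hr0.ne']
    congr 1
  calc hermBound N * Real.sqrt s ^ N * (1 + x) ^ N * gauss s k *
        (5 / 96 * (Real.sqrt s ^ (-2 : ℤ) * (1 + x) ^ 4) * Real.exp (5 / 96 * (s * k ^ 2)))
      = hermBound N * (5 / 96) * (Real.sqrt s ^ N * Real.sqrt s ^ (-2 : ℤ)) *
          (((1 + x) ^ N * (1 + x) ^ 4) * gauss s k * Real.exp (5 / 96 * (s * k ^ 2))) := by ring
    _ = hermBound N * (5 / 96) * Real.sqrt s ^ ((N : ℤ) - 2) *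
          ((1 + x) ^ (N + 4) * gauss s k * Real.exp (5 / 96 * (s * k ^ 2))) := by rw [hpow, hz]
    _ ≤ hermBound N * (5 / 96) * Real.sqrt s ^ ((N : ℤ) - 2) * (B * Real.exp (-(s * k ^ 2 / 8))) := by
        refine mul_le_mul_of_nonneg_left hA ?_
        have := hermBound_nonneg N
        have := zpow_nonneg hr0.le ((N : ℤ) - 2)
        positivity
    _ = hermBound N * (5 / 96) * B * Real.sqrt s ^ ((N : ℤ) - 2) * Real.exp (-(s * k ^ 2 / 8)) := by ring

/-- **The near bound.** For every `N` there is `C ≥ 0` with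
`|∂_k^N e^{-s(1 - cos k)} - ∂_k^N e^{-sk²/2}| ≤ C √s^{N-2} e^{-sk²/8}` for all `s ≥ 1`, `|k| ≤ 1`.
(Leibniz: the `i = N` term minus the Gaussian is `∂^N gauss · (corr - 1)`; the terms `i < N`
carry `∂^{N-i} corr`, `N - i ≥ 1`.) [folklore] -/
theorem exists_near_bound (N : ℕ) :
    ∃ C : ℝ, 0 ≤ C ∧ ∀ s : ℝ, 1 ≤ s → ∀ k : ℝ, |k| ≤ 1 →
      |iteratedDeriv N (heat s) k - iteratedDeriv N (gauss s) k| ≤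
        C * Real.sqrt s ^ ((N : ℤ) - 2) * Real.exp (-(s * k ^ 2 / 8)) := by
  -- constants for the cross terms, uniformly packaged over `i`
  have key : ∀ i : ℕ, ∃ C : ℝ, 0 ≤ C ∧ ∀ s : ℝ, 1 ≤ s → ∀ k : ℝ, |k| ≤ 1 → i < N →
      |(N.choose i : ℝ) * iteratedDeriv i (gauss s) k * iteratedDeriv (N - i) (corr s) k| ≤
        C * Real.sqrt s ^ ((N : ℤ) - 2) * Real.exp (-(s * k ^ 2 / 8)) := by
    intro i
    by_cases hi : i < N
    · obtain ⟨C, hC, h⟩ := exists_cross_term_bound i (N - i - 1)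
      refine ⟨(N.choose i : ℝ) * C, by positivity, fun s hs k hk _ => ?_⟩
      have hj : N - i = N - i - 1 + 1 := by omega
      have hz : ((i : ℤ) + ((N - i - 1 : ℕ) : ℤ) - 1) = (N : ℤ) - 2 := by
        have : i + 1 ≤ N := hi
        push_cast [Nat.cast_sub (show 1 ≤ N - i by omega), Nat.cast_sub (show i ≤ N by omega)]
        ring
      rw [hj, mul_assoc, abs_mul, Nat.abs_cast]
      have h' := h s hs k hk
      rw [hz] at h'
      calc (N.choose i : ℝ) * |iteratedDeriv i (gauss s) k * iteratedDeriv (N - i - 1 + 1) (corr s) k|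
          ≤ (N.choose i : ℝ) * (C * Real.sqrt s ^ ((N : ℤ) - 2) * Real.exp (-(s * k ^ 2 / 8))) :=
            mul_le_mul_of_nonneg_left h' (Nat.cast_nonneg _)
        _ = _ := by ring
    · exact ⟨0, le_rfl, fun s _ k _ h => absurd h hi⟩
  choose Cf hCf0 hCf using key
  obtain ⟨C₀, hC₀, h₀⟩ := exists_main_term_bound N
  refine ⟨(∑ i ∈ Finset.range N, Cf i) + C₀,
    add_nonneg (Finset.sum_nonneg fun i _ => hCf0 i) hC₀, fun s hs k hk => ?_⟩
  have hr0 : 0 < Real.sqrt s := by linarith [one_le_sqrt_of_one_le hs]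
  -- Leibniz and splitting off `i = N`
  rw [iteratedDeriv_heat_eq_sum N s k, Finset.sum_range_succ, Nat.choose_self, Nat.cast_one, one_mul,
    Nat.sub_self, iteratedDeriv_zero]
  have hsplit : (∑ i ∈ Finset.range N, (N.choose i : ℝ) * iteratedDeriv i (gauss s) k *
        iteratedDeriv (N - i) (corr s) k) + iteratedDeriv N (gauss s) k * corr s k -
        iteratedDeriv N (gauss s) k =
      (∑ i ∈ Finset.range N, (N.choose i : ℝ) * iteratedDeriv i (gauss s) k *
        iteratedDeriv (N - i) (corr s) k) + iteratedDeriv N (gauss s) k * (corr s k - 1) := by ring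
  rw [hsplit]
  set E : ℝ := Real.sqrt s ^ ((N : ℤ) - 2) * Real.exp (-(s * k ^ 2 / 8)) with hE
  have hE0 : 0 ≤ E := mul_nonneg (zpow_nonneg hr0.le _) (Real.exp_pos _).le
  calc |(∑ i ∈ Finset.range N, (N.choose i : ℝ) * iteratedDeriv i (gauss s) k *
          iteratedDeriv (N - i) (corr s) k) + iteratedDeriv N (gauss s) k * (corr s k - 1)|
      ≤ |∑ i ∈ Finset.range N, (N.choose i : ℝ) * iteratedDeriv i (gauss s) k *
          iteratedDeriv (N - i) (corr s) k| + |iteratedDeriv N (gauss s) k * (corr s k - 1)| :=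
        abs_add_le _ _
    _ ≤ (∑ i ∈ Finset.range N, Cf i * E) + C₀ * E := by
        refine add_le_add ((Finset.abs_sum_le_sum_abs _ _).trans (Finset.sum_le_sum fun i hi => ?_)) ?_
        · have := hCf i s hs k hk (Finset.mem_range.1 hi)
          rw [hE, ← mul_assoc]; exact this
        · rw [hE, ← mul_assoc]; exact h₀ s hs k hk
    _ = ((∑ i ∈ Finset.range N, Cf i) + C₀) * Real.sqrt s ^ ((N : ℤ) - 2) * Real.exp (-(s * k ^ 2 / 8)) := by
        rw [hE, ← Finset.sum_mul]; ring

/-! ### The far bounds -/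

/-- **Far bound on the torus**: `|∂_k^N e^{-s(1 - cos k)}| ≤ C s^N e^{-(2/π²) s}` for `s ≥ 1`,
`1 ≤ |k| ≤ π` (the symbol is in `GoodSym N N`, and `1 - cos k ≥ (2/π²)k² ≥ 2/π²` by Mathlib's
`Real.cos_le_one_sub_mul_cos_sq`). [folklore] -/
theorem exists_far_bound_heat (N : ℕ) :
    ∃ C : ℝ, 0 ≤ C ∧ ∀ s : ℝ, 1 ≤ s → ∀ k : ℝ, 1 ≤ |k| → |k| ≤ Real.pi →
      |iteratedDeriv N (heat s) k| ≤ C * s ^ N * Real.exp (-(2 / Real.pi ^ 2 * s)) := by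
  obtain ⟨P, hP, hPd⟩ := exists_goodSym_iteratedDeriv_heat N
  obtain ⟨C, hC, hPb⟩ := hP.far_bound Real.pi_pos.le
  refine ⟨C, hC, fun s hs k hk1 hkπ => ?_⟩
  have hs0 : 0 ≤ s := by linarith
  rw [hPd s k, abs_mul, abs_of_pos (heat_pos s k)]
  have hheat : heat s k ≤ Real.exp (-(2 / Real.pi ^ 2 * s)) := by
    unfold heat
    refine Real.exp_le_exp.2 (neg_le_neg ?_)
    have hcos := Real.cos_le_one_sub_mul_cos_sq hkπ
    have hk2 : 1 ≤ k ^ 2 := by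
      have : 1 ≤ |k| ^ 2 := by nlinarith
      rwa [sq_abs] at this
    have hπ2 : 0 < 2 / Real.pi ^ 2 := by positivity
    calc 2 / Real.pi ^ 2 * s = s * (2 / Real.pi ^ 2 * 1) := by ring
      _ ≤ s * (2 / Real.pi ^ 2 * k ^ 2) := by
          refine mul_le_mul_of_nonneg_left (mul_le_mul_of_nonneg_left hk2 hπ2.le) hs0
      _ ≤ s * (1 - Real.cos k) := mul_le_mul_of_nonneg_left (by linarith) hs0
  calc heat s k * |P s k| ≤ Real.exp (-(2 / Real.pi ^ 2 * s)) * (C * s ^ N) :=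
        mul_le_mul hheat (hPb s hs k hkπ) (abs_nonneg _) (Real.exp_pos _).le
    _ = C * s ^ N * Real.exp (-(2 / Real.pi ^ 2 * s)) := by ring

/-- **Global Gaussian derivative bound**: `|∂_k^N e^{-sk²/2}| ≤ C √s^N e^{-sk²/4}` for `s ≥ 0`.
[folklore] -/
theorem exists_global_bound_gauss (N : ℕ) :
    ∃ C : ℝ, 0 ≤ C ∧ ∀ s : ℝ, 0 ≤ s → ∀ k : ℝ,
      |iteratedDeriv N (gauss s) k| ≤ C * Real.sqrt s ^ N * Real.exp (-(s * k ^ 2 / 4)) := by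
  obtain ⟨B, hB, h⟩ := exists_pow_mul_exp_neg_sq_le N (show (0 : ℝ) < 1 / 4 by norm_num)
  refine ⟨hermBound N * B, by positivity [hermBound_nonneg N], fun s hs k => ?_⟩
  have hx : 0 ≤ Real.sqrt s * |k| := mul_nonneg (Real.sqrt_nonneg s) (abs_nonneg k)
  have hkey := h _ hx
  rw [sqrt_mul_abs_sq hs] at hkey
  have hg := abs_iteratedDeriv_gauss_le N hs k
  have hsplit : gauss s k = Real.exp (-(1 / 4 * (s * k ^ 2))) * Real.exp (-(s * k ^ 2 / 4)) := by
    unfold gauss; rw [← Real.exp_add]; congr 1; ring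
  refine hg.trans ?_
  rw [hsplit]
  have h0 : 0 ≤ hermBound N * Real.sqrt s ^ N := mul_nonneg (hermBound_nonneg N) (pow_nonneg (Real.sqrt_nonneg s) N)
  calc hermBound N * Real.sqrt s ^ N * (1 + Real.sqrt s * |k|) ^ N *
        (Real.exp (-(1 / 4 * (s * k ^ 2))) * Real.exp (-(s * k ^ 2 / 4)))
      = hermBound N * Real.sqrt s ^ N *
          (((1 + Real.sqrt s * |k|) ^ N * Real.exp (-(1 / 4 * (s * k ^ 2)))) * Real.exp (-(s * k ^ 2 / 4))) := by
        ring
    _ ≤ hermBound N * Real.sqrt s ^ N * (B * Real.exp (-(s * k ^ 2 / 4))) :=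
        mul_le_mul_of_nonneg_left (mul_le_mul_of_nonneg_right hkey (Real.exp_pos _).le) h0
    _ = hermBound N * B * Real.sqrt s ^ N * Real.exp (-(s * k ^ 2 / 4)) := by ring

/-- **Far Gaussian bound**: `|∂_k^N e^{-sk²/2}| ≤ C √s^N e^{-s/4} e^{-sk²/8}` for `s ≥ 0`, `|k| ≥ 1`.
[folklore] -/
theorem exists_far_bound_gauss (N : ℕ) :
    ∃ C : ℝ, 0 ≤ C ∧ ∀ s : ℝ, 0 ≤ s → ∀ k : ℝ, 1 ≤ |k| →
      |iteratedDeriv N (gauss s) k| ≤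
        C * Real.sqrt s ^ N * Real.exp (-(s / 4)) * Real.exp (-(s * k ^ 2 / 8)) := by
  obtain ⟨B, hB, h⟩ := exists_pow_mul_exp_neg_sq_le N (show (0 : ℝ) < 1 / 8 by norm_num)
  refine ⟨hermBound N * B, by positivity [hermBound_nonneg N], fun s hs k hk => ?_⟩
  have hx : 0 ≤ Real.sqrt s * |k| := mul_nonneg (Real.sqrt_nonneg s) (abs_nonneg k)
  have hkey := h _ hx
  rw [sqrt_mul_abs_sq hs] at hkey
  have hg := abs_iteratedDeriv_gauss_le N hs k
  have hk2 : 1 ≤ k ^ 2 := by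
    have : 1 ≤ |k| ^ 2 := by nlinarith
    rwa [sq_abs] at this
  have htail : Real.exp (-(s * k ^ 2 / 4)) ≤ Real.exp (-(s / 4)) := by
    refine Real.exp_le_exp.2 (neg_le_neg ?_)
    have : s * 1 ≤ s * k ^ 2 := mul_le_mul_of_nonneg_left hk2 hs
    linarith
  have hsplit : gauss s k =
      Real.exp (-(1 / 8 * (s * k ^ 2))) * Real.exp (-(s * k ^ 2 / 4)) * Real.exp (-(s * k ^ 2 / 8)) := by
    unfold gauss; rw [← Real.exp_add, ← Real.exp_add]; congr 1; ring
  refine hg.trans ?_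
  rw [hsplit]
  have h0 : 0 ≤ hermBound N * Real.sqrt s ^ N := mul_nonneg (hermBound_nonneg N) (pow_nonneg (Real.sqrt_nonneg s) N)
  calc hermBound N * Real.sqrt s ^ N * (1 + Real.sqrt s * |k|) ^ N *
        (Real.exp (-(1 / 8 * (s * k ^ 2))) * Real.exp (-(s * k ^ 2 / 4)) * Real.exp (-(s * k ^ 2 / 8)))
      = hermBound N * Real.sqrt s ^ N *
          (((1 + Real.sqrt s * |k|) ^ N * Real.exp (-(1 / 8 * (s * k ^ 2)))) *
            Real.exp (-(s * k ^ 2 / 4)) * Real.exp (-(s * k ^ 2 / 8))) := by ring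
    _ ≤ hermBound N * Real.sqrt s ^ N * (B * Real.exp (-(s / 4)) * Real.exp (-(s * k ^ 2 / 8))) := by
        refine mul_le_mul_of_nonneg_left ?_ h0
        refine mul_le_mul_of_nonneg_right ?_ (Real.exp_pos _).le
        exact mul_le_mul hkey htail (Real.exp_pos _).le hB
    _ = hermBound N * B * Real.sqrt s ^ N * Real.exp (-(s / 4)) * Real.exp (-(s * k ^ 2 / 8)) := by ring

end SRWGreen

end Literature.Barriers.CriticalPhenomena

end
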